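import Literature.AnabelianGeometry.EtaleTheta.FrobenioidMonoTheta
import Literature.AnabelianGeometry.EtaleTheta.FrobenioidCyclotomicRigidity
import Literature.AnabelianGeometry.EtaleTheta.MonoThetaEnv
import Mathlib.GroupTheory.Subgroup.Centralizer

/-!
# [EtTh] §5: the Frobenioid-theoretic mono-theta environment — Lemma 5.9 (iv), (v), Theorem 5.10 (iii) (pp. 332–335 / PDF pp. 106–109)

Mochizuki, *The étale theta function …*, Publ. RIMS **45** (2009) [cite: MochizukiEtTh2009, §5 p.332 (PDF p.106)].
Seat abc-iut-L2-t4.  This file relates the §5 data `ThetaFrobenioid` (sibling files) to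
abc-iut-L2-t2's mono- and bi-theta environments (`MonoThetaEnv.lean`: `MonoThetaEnv`, `BiThetaEnv`,
`ThetaEnvData`, `IsMonoThetaEnv`, `modelBi`):
* the "evident topology" on `E^Π_N = E_N ×_{Im(Π^tp_Y̲)} Π^tp_Y̲` (p.332 (PDF p.106)): `Aut_C(B_N)` discrete, `Π^tp_X̲`
  tempered (`epinTopology`);
* the conjugation action of `Π^tp_X̲` on `E^Π_N` through `g ↦ (s^⊓-gp_N(ρ g), g)` (Lemma 5.9 (iii))
  and of the constants `(O_K^×)^{1/N}` through `u ↦ (u, 1)` (Lemma 5.8), as bi-continuous automorphisms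
  of `E^Π_N`, hence elements of `Out(E^Π_N)` — CONSTRUCTED (`liftPi_mem_normalizer`,
  `liftConst_mem_normalizer`, `conjOut`) modulo the named facts of `FrobenioidMonoTheta.lean`;
* the homomorphisms `s^⊓-Π_N, s^⊔-Π_N : Π^tp_Ÿ̲ → E^Π_N` "arising from `s^⊓-gp_N, s^⊔-gp_N`" (p.332 (PDF p.106))
  (`sCapPi`, `sCupPi`) and the bi-theta environment DATA on `E^Π_N` (`frdBiThetaEnv`; "omitting the
  homomorphism `s^⊓-Π_N`": `frdMonoThetaEnv`);
* **Lemma 5.9 (iv)** (`EnvIsoBiTheta`: `E^Π_N ⥲ Π^tp_Y̲[μ_N]` is an isomorphism of mod `N` bi-theta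
  environments with the model one) and its "In particular" (`frdMonoThetaEnv` IS a mono-theta
  environment — PROVED from (iv): `isMonoThetaEnv_of_envIsoBiTheta`); **Lemma 5.9 (v)**
  (`CycRigidityCoincide`); **Theorem 5.10 (iii)** (`MonoThetaEnvCompat`).
Deviation recorded (nothing silently dropped): the `K^×`-part of `D` — "this outer action extends to an
outer action of `(K^×)^{1/N}/μ_N(B_N) ⥲ K^×` on `E_N`" (Lemma 5.8) — needs the birationalization
`Aut_{C^birat}(B_N^birat)`, which the §5 data stub does not carry; the subgroup `D` below is therefore
generated by the `l·ℤ`-part and the `(O_K^×)^{1/N}`-part together with a PARAMETER `DK` for the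
remaining Kummer part (`TODO-merge(abc-iut-L2-t3)`: birationalization, [FrdI] Prop. 4.4).  The
identification of `Π^tp_X̲, Π^tp_Y̲, Π^tp_Ÿ̲` with abc-iut-L2-t2's `ThetaEnvData` fields is an explicit
isomorphism `ι` (parameter) until the two interfaces are merged.  Universe note: `E^Π_N` lives in the
hom-universe `v` of `C` (= the universe of `Π^tp_X̲`), so abc-iut-L2-t2's structures are taken at
`MonoThetaEnv.{v}` / `ThetaEnvData.{v}`.  HONEST FRAMING: typed ≠ proved except for `theorem`s.

v2 (R-9 repair, filed by abc-iut-L6-t23 for abc-iut-L2-t4; RQ7 finding F2 21:13:41Z, shape (F2-a) of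
abc-iut-L2-d4 22:24:06Z): `MonoThetaEnvCompat` (Thm. 5.10 (iii)) now takes as HYPOTHESES that `ψY` lies over
`Ψ^Aut` through `ρ` and stabilises `Π^tp_Y̲`, `Π^tp_Ÿ̲` (print: "compatible with the `Π^tp_X`-conjugacy class
of automorphisms of `Π^tp_Y` induced by `Ψ^bs` [cf. Theorem 4.4]"), and concludes for a `Π^tp_X̲`-conjugate of
`ψY`; findings F1 (`DK`) / F3 (`T`, `ι`, `ρ219`, `ρ`) remain documented `TODO-merge` parameters. Nothing else
changed.
-/

namespace Literature.AnabelianGeometry.EtaleTheta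

open CategoryTheory
open scoped Pointwise

universe w v v' u u'

/-- An isomorphism of bi-theta environments induces one of the underlying mono-theta environments
("omitting" `s^alg`; Def. 2.13 (iii)).  [cite: MochizukiEtTh2009, Lem 5.9 (iv) p.332 (PDF p.106)] -/
def BiThetaEnv.Iso.toMonoIso {B B' : BiThetaEnv.{v}} (i : B.Iso B') : B.toMono.Iso B'.toMono where
  e := i.e
  map_D := i.map_D
  map_sTheta := i.map_sTheta

namespace ThetaFrobenioid

variable {C : Type u} [Category.{v} C] {D : Type u'} [Category.{v'} D] (𝔉 : ThetaFrobenioid.{w} C D)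

/-! ### The topology on `E^Π_N` (p.332 (PDF p.106) "equipped with the evident topologies") -/

/-- The discrete topology on `Aut_C(B_N)` (an abstract group; `μ_N(B_N)` is finite), used only to
topologise `E^Π_N`.  [cite: MochizukiEtTh2009, Lem 5.9 (iv) p.332 (PDF p.106)] -/
@[reducible] def autDiscrete : TopologicalSpace (Aut 𝔉.BN) := ⊥

/-- The ambient topology on `Aut_C(B_N) × Π^tp_X̲`: discrete × tempered.
[cite: MochizukiEtTh2009, Lem 5.9 (iv) p.332 (PDF p.106)] -/
@[reducible] def ambientTopology : TopologicalSpace (Aut 𝔉.BN × 𝔉.PiX) :=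
  @instTopologicalSpaceProd (Aut 𝔉.BN) 𝔉.PiX 𝔉.autDiscrete inferInstance

/-- "`E_N`, `E^Π_N` are equipped with the evident topologies" (p.332 (PDF p.106)): on
`E^Π_N ⊆ Aut_C(B_N) × Π^tp_X̲` the subspace topology of discrete × tempered (so `E^Π_N` is, as a space,
`μ_N(B_N) × Π^tp_Y̲` once `s^⊓-gp_N` splits it).  [cite: MochizukiEtTh2009, Lem 5.9 (iv) p.332 (PDF p.106)] -/
instance epinTopology : TopologicalSpace 𝔉.EPiN :=
  TopologicalSpace.induced (fun x => (x : Aut 𝔉.BN × 𝔉.PiX)) 𝔉.ambientTopology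

/-- Conjugation by an element of the ambient group preserving `E^Π_N` is continuous for this topology.
[cite: MochizukiEtTh2009, Lem 5.9 (iv) p.332 (PDF p.106)] -/
theorem continuous_conj_ambient (n : Aut 𝔉.BN × 𝔉.PiX) :
    @Continuous _ _ 𝔉.ambientTopology 𝔉.ambientTopology fun p => n * p * n⁻¹ := by
  letI : TopologicalSpace (Aut 𝔉.BN) := 𝔉.autDiscrete
  haveI : DiscreteTopology (Aut 𝔉.BN) := ⟨rfl⟩
  letI : TopologicalSpace (Aut 𝔉.BN × 𝔉.PiX) := 𝔉.ambientTopology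
  have h1 : Continuous fun p : Aut 𝔉.BN × 𝔉.PiX => n.1 * p.1 * n.1⁻¹ :=
    (continuous_of_discreteTopology (f := fun a : Aut 𝔉.BN => n.1 * a * n.1⁻¹)).comp continuous_fst
  have h2 : Continuous fun p : Aut 𝔉.BN × 𝔉.PiX => n.2 * p.2 * n.2⁻¹ :=
    (continuous_const.mul continuous_snd).mul continuous_const
  exact h1.prodMk h2

/-- For `n` in the normaliser of `E^Π_N`, the induced automorphism of `E^Π_N` is bi-continuous, i.e.
lies in `contMulAut(E^Π_N)` (abc-iut-L2-t2's `contMulAut`).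
[cite: MochizukiEtTh2009, Lem 5.9 (iv) p.332 (PDF p.106)] -/
theorem normalizerMonoidHom_mem_contMulAut
    (n : Subgroup.normalizer (𝔉.EPiN : Set (Aut 𝔉.BN × 𝔉.PiX))) :
    𝔉.EPiN.normalizerMonoidHom n ∈ contMulAut 𝔉.EPiN := by
  letI : TopologicalSpace (Aut 𝔉.BN × 𝔉.PiX) := 𝔉.ambientTopology
  have key : ∀ m : Subgroup.normalizer (𝔉.EPiN : Set (Aut 𝔉.BN × 𝔉.PiX)),
      Continuous fun x : 𝔉.EPiN => 𝔉.EPiN.normalizerMonoidHom m x := by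
    intro m
    apply continuous_induced_rng.2
    change Continuous fun x : 𝔉.EPiN =>
      ((𝔉.EPiN.normalizerMonoidHom m x : 𝔉.EPiN) : Aut 𝔉.BN × 𝔉.PiX)
    have : (fun x : 𝔉.EPiN => ((𝔉.EPiN.normalizerMonoidHom m x : 𝔉.EPiN) : Aut 𝔉.BN × 𝔉.PiX)) =
        (fun p => (m : Aut 𝔉.BN × 𝔉.PiX) * p * (m : Aut 𝔉.BN × 𝔉.PiX)⁻¹) ∘
          fun x : 𝔉.EPiN => (x : Aut 𝔉.BN × 𝔉.PiX) := by
      funext x; rfl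
    rw [this]
    exact (𝔉.continuous_conj_ambient _).comp continuous_induced_dom
  refine ⟨key n, ?_⟩
  change Continuous fun x => (𝔉.EPiN.normalizerMonoidHom n).symm x
  have : (fun x => (𝔉.EPiN.normalizerMonoidHom n).symm x) =
      fun x => 𝔉.EPiN.normalizerMonoidHom n⁻¹ x := by
    funext x
    rw [map_inv]
    rfl
  rw [this]
  exact key n⁻¹

/-- The element of `Out(E^Π_N)` (abc-iut-L2-t2's `TopOut`) defined by conjugation by `n`.
[cite: MochizukiEtTh2009, Lem 5.9 (iii)/(iv) p.332 (PDF p.106)] -/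
def conjOut (n : Subgroup.normalizer (𝔉.EPiN : Set (Aut 𝔉.BN × 𝔉.PiX))) : TopOut 𝔉.EPiN :=
  TopOut.mk _ ⟨𝔉.EPiN.normalizerMonoidHom n, 𝔉.normalizerMonoidHom_mem_contMulAut n⟩

/-! ### The outer actions of `Π^tp_X̲` (Lemma 5.9 (iii)) and of the constants (Lemma 5.8) on `E^Π_N` -/

/-- `g ↦ (s^⊓-gp_N(ρ g), g)`: the lift to `Aut_C(B_N) × Π^tp_X̲` of "the composite of the natural outer
homomorphism `Π^tp_X ↠ Aut_D(B_N^bs)` with `s^⊓-gp_N`" (Lemma 5.9 (iii), p.332 (PDF p.106)).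
[cite: MochizukiEtTh2009, Lem 5.9 (iii) p.332 (PDF p.106)] -/
def liftPi : 𝔉.PiX →* Aut 𝔉.BN × 𝔉.PiX := (𝔉.sgpCap.comp 𝔉.ρ).prod (MonoidHom.id _)

/-- One inclusion of the normaliser property of `liftPi g` (conjugation by `(s^⊓-gp_N(ρ g), g)` maps
`E^Π_N` into itself; Lemma 5.9 (iii) lifted).  [cite: MochizukiEtTh2009, Lem 5.9 (iii) p.332 (PDF p.106)] -/
theorem liftPi_conj_mem (h3 : 𝔉.OuterActionLZ) (hsec : 𝔉.SgpCapSection) (g : 𝔉.PiX)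
    {x : Aut 𝔉.BN × 𝔉.PiX} (hx : x ∈ 𝔉.EPiN) :
    𝔉.liftPi g * x * (𝔉.liftPi g)⁻¹ ∈ 𝔉.EPiN := by
  obtain ⟨he, hy, hc⟩ := hx
  have hn : 𝔉.sgpCap (𝔉.ρ g) ∈ Subgroup.normalizer (𝔉.EN : Set (Aut 𝔉.BN)) :=
    h3 ⟨g, Subgroup.mem_top g, rfl⟩
  refine ⟨(Subgroup.mem_normalizer_iff.mp hn x.1).mp he, 𝔉.PiY_normal.conj_mem _ hy g, ?_⟩
  change 𝔉.autBase 𝔉.BN (𝔉.sgpCap (𝔉.ρ g) * x.1 * (𝔉.sgpCap (𝔉.ρ g))⁻¹) = 𝔉.ρ (g * x.2 * g⁻¹)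
  rw [map_mul, map_mul, map_inv, hsec, hc, map_mul, map_mul, map_inv]

/-- `(s^⊓-gp_N(ρ g), g)` normalises `E^Π_N` (from Lemma 5.9 (iii): `s^⊓-gp_N(ρ g)` normalises `E_N`, and
the section property of `s^⊓-gp_N`).  [cite: MochizukiEtTh2009, Lem 5.9 (iii) p.332 (PDF p.106)] -/
theorem liftPi_mem_normalizer (h3 : 𝔉.OuterActionLZ) (hsec : 𝔉.SgpCapSection) (g : 𝔉.PiX) :
    𝔉.liftPi g ∈ Subgroup.normalizer (𝔉.EPiN : Set (Aut 𝔉.BN × 𝔉.PiX)) := by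
  rw [Subgroup.mem_normalizer_iff]
  intro x
  constructor
  · exact 𝔉.liftPi_conj_mem h3 hsec g
  · intro hx
    have := 𝔉.liftPi_conj_mem h3 hsec g⁻¹ hx
    simpa [map_inv, mul_assoc] using this

/-- The outer action `Π^tp_X̲ → Out(E^Π_N)` by conjugation through `liftPi` (Lemma 5.9 (iii), lifted to
`E^Π_N`; it descends to `l·ℤ ≅ Π^tp_X̲/Π^tp_Y̲` since `Π^tp_Y̲` acts innerly).
[cite: MochizukiEtTh2009, Lem 5.9 (iii) p.332 (PDF p.106)] -/
noncomputable def galOut (h3 : 𝔉.OuterActionLZ) (hsec : 𝔉.SgpCapSection) : Set (TopOut 𝔉.EPiN) :=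
  Set.range fun g : 𝔉.PiX => 𝔉.conjOut ⟨𝔉.liftPi g, 𝔉.liftPi_mem_normalizer h3 hsec g⟩

/-- `(u, 1)` normalises `E^Π_N` for `u ∈ O^×(B_N)` normalising `E_N` (Lemma 5.8: these are exactly the
elements of `(O_K^×)^{1/N}`).  [cite: MochizukiEtTh2009, Lem 5.8 p.331 (PDF p.105)] -/
theorem liftConst_mem_normalizer {u : Aut 𝔉.BN} (hu : u ∈ 𝔉.units 𝔉.BN)
    (hn : u ∈ Subgroup.normalizer (𝔉.EN : Set (Aut 𝔉.BN))) :
    ((u, 1) : Aut 𝔉.BN × 𝔉.PiX) ∈ Subgroup.normalizer (𝔉.EPiN : Set (Aut 𝔉.BN × 𝔉.PiX)) := by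
  have hub : 𝔉.autBase 𝔉.BN u = 1 := by
    apply Aut.ext; exact 𝔉.base_map_units 𝔉.BN u hu
  have key : ∀ {v : Aut 𝔉.BN}, v ∈ Subgroup.normalizer (𝔉.EN : Set (Aut 𝔉.BN)) →
      𝔉.autBase 𝔉.BN v = 1 → ∀ {x : Aut 𝔉.BN × 𝔉.PiX}, x ∈ 𝔉.EPiN →
      ((v, 1) : Aut 𝔉.BN × 𝔉.PiX) * x * (v, 1)⁻¹ ∈ 𝔉.EPiN := by
    intro v hv hvb x hx
    obtain ⟨he, hy, hc⟩ := hx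
    refine ⟨(Subgroup.mem_normalizer_iff.mp hv x.1).mp he, by simpa using hy, ?_⟩
    change 𝔉.autBase 𝔉.BN (v * x.1 * v⁻¹) = 𝔉.ρ (1 * x.2 * 1⁻¹)
    rw [map_mul, map_mul, map_inv, hvb, hc]; simp
  rw [Subgroup.mem_normalizer_iff]
  intro x
  constructor
  · exact key hn hub
  · intro hx
    have hn' : u⁻¹ ∈ Subgroup.normalizer (𝔉.EN : Set (Aut 𝔉.BN)) := Subgroup.inv_mem _ hn
    have hub' : 𝔉.autBase 𝔉.BN u⁻¹ = 1 := by rw [map_inv, hub, inv_one]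
    have := key hn' hub' hx
    simpa [mul_assoc] using this

/-- The outer action of the constants `(O_K^×)^{1/N}` on `E^Π_N` by conjugation through `u ↦ (u, 1)`
(Lemma 5.8: "a natural outer action of `(O_K^×)^{1/N}/μ_N(B_N) ⥲ O_K^×` on `E_N`"), defined using the
conclusion of Lemma 5.8 (`ConstantsEqNormalizer`) as hypothesis.
[cite: MochizukiEtTh2009, Lem 5.8 p.331 (PDF p.105)] -/
noncomputable def constOut (h8 : 𝔉.ConstantsEqNormalizer) : Set (TopOut 𝔉.EPiN) :=
  Set.range fun u : 𝔉.OKxRootN =>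
    𝔉.conjOut ⟨((u : Aut 𝔉.BN), 1), by
      have hu : (u : Aut 𝔉.BN) ∈ 𝔉.units 𝔉.BN ⊓ Subgroup.normalizer (𝔉.EN : Set (Aut 𝔉.BN)) :=
        h8 ▸ u.2
      exact 𝔉.liftConst_mem_normalizer hu.1 hu.2⟩

/-! ### The sections `s^⊓-Π_N, s^⊔-Π_N : Π^tp_Ÿ̲ → E^Π_N` and the theta-environment data on `E^Π_N` -/

/-- `ρ` restricted to `Π^tp_Ÿ̲`, with values in `H_{B_N} = ρ(Π^tp_Ÿ̲)`.
[cite: MochizukiEtTh2009, §5 p.331 (PDF p.105)] -/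
def rhoYdd : 𝔉.PiYdd →* 𝔉.HB :=
  (𝔉.ρ.comp 𝔉.PiYdd.subtype).codRestrict 𝔉.HB fun h => ⟨h, h.2, rfl⟩

/-- `s^⊔-Π_N : Π^tp_Ÿ̲ → E^Π_N`, `h ↦ (s^⊔-gp_N(ρ h), h)`, "arising from `s^⊔-gp_N`" (Lemma 5.9 (iv), p.332 (PDF p.106));
well defined by Lemma 5.9 (i) and the section property.  [cite: MochizukiEtTh2009, Lem 5.9 (iv) p.332 (PDF p.106)] -/
def sCupPi (h1 : 𝔉.SectionsFactor) (hcs : 𝔉.SgpCupSection) : 𝔉.PiYdd →* 𝔉.EPiN :=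
  ((𝔉.sgpCup.comp 𝔉.rhoYdd).prod 𝔉.PiYdd.subtype).codRestrict 𝔉.EPiN fun h =>
    ⟨h1.2 _, 𝔉.PiYdd_le h.2, hcs _⟩

/-- Underlying pair of `s^⊔-Π_N(h)`. [cite: MochizukiEtTh2009, Lem 5.9 (iv) p.332 (PDF p.106)] -/
@[simp] theorem coe_sCupPi (h1 : 𝔉.SectionsFactor) (hcs : 𝔉.SgpCupSection) (h : 𝔉.PiYdd) :
    ((𝔉.sCupPi h1 hcs h : 𝔉.EPiN) : Aut 𝔉.BN × 𝔉.PiX) = (𝔉.sgpCup (𝔉.rhoYdd h), (h : 𝔉.PiX)) := rfl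

/-- `s^⊓-Π_N : Π^tp_Ÿ̲ → E^Π_N`, `h ↦ (s^⊓-gp_N(ρ h), h)`, "arising from `s^⊓-gp_N`" (Lemma 5.9 (iv), p.332 (PDF p.106)).
[cite: MochizukiEtTh2009, Lem 5.9 (iv) p.332 (PDF p.106)] -/
def sCapPi (hsec : 𝔉.SgpCapSection) : 𝔉.PiYdd →* 𝔉.EPiN :=
  (((𝔉.sgpCap.comp 𝔉.ρ).comp 𝔉.PiYdd.subtype).prod 𝔉.PiYdd.subtype).codRestrict 𝔉.EPiN fun h =>
    ⟨𝔉.sgpCap_rho_mem_EN (𝔉.PiYdd_le h.2), 𝔉.PiYdd_le h.2, hsec _⟩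

/-- Underlying pair of `s^⊓-Π_N(h)`. [cite: MochizukiEtTh2009, Lem 5.9 (iv) p.332 (PDF p.106)] -/
@[simp] theorem coe_sCapPi (hsec : 𝔉.SgpCapSection) (h : 𝔉.PiYdd) :
    ((𝔉.sCapPi hsec h : 𝔉.EPiN) : Aut 𝔉.BN × 𝔉.PiX) = (𝔉.sgpCap (𝔉.ρ h), (h : 𝔉.PiX)) := rfl

/-- `μ_N(B_N) ↪ E^Π_N`, `u ↦ (u, 1)` ("the natural inclusion `μ_N(B_N) ↪ E_N`", Lemma 5.9 (iv)).
[cite: MochizukiEtTh2009, Lem 5.9 (iv) p.332 (PDF p.106)] -/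
def muIncl : 𝔉.muTorsion 𝔉.BN 𝔉.N →* 𝔉.EPiN :=
  ((𝔉.muTorsion 𝔉.BN 𝔉.N).subtype.prod 1).codRestrict 𝔉.EPiN fun u =>
    ⟨le_sectionSubgroup _ _ _ u.2, 𝔉.PiY.one_mem, by
      have := 𝔉.muTorsion_le_ker 𝔉.BN 𝔉.N u.2
      rw [MonoidHom.mem_ker] at this
      simpa using this⟩

/-- Underlying pair of `μ_N(B_N) ↪ E^Π_N`. [cite: MochizukiEtTh2009, Lem 5.9 (iv) p.332 (PDF p.106)] -/
@[simp] theorem coe_muIncl (u : 𝔉.muTorsion 𝔉.BN 𝔉.N) :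
    ((𝔉.muIncl u : 𝔉.EPiN) : Aut 𝔉.BN × 𝔉.PiX) = ((u : Aut 𝔉.BN), 1) := rfl

/-- `E^Π_N ↠ Π^tp_Y̲` is onto (split by `y ↦ (s^⊓-gp_N(ρ y), y)`), given the section property of
`s^⊓-gp_N`.  [cite: MochizukiEtTh2009, Lem 5.9 (iv) p.332 (PDF p.106)] -/
theorem toPiY_range (hsec : 𝔉.SgpCapSection) : 𝔉.toPiY.range = 𝔉.PiY := by
  apply le_antisymm
  · rintro _ ⟨x, rfl⟩
    exact 𝔉.toPiY_mem_PiY x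
  · intro y hy
    exact ⟨⟨(𝔉.sgpCap (𝔉.ρ y), y), ⟨𝔉.sgpCap_rho_mem_EN hy, hy, hsec _⟩⟩, rfl⟩

/-- **"The distinct cyclotome"** (Rmk. 5.10.3, p.336 (PDF p.110)): `μ_N(B_N) ≅ Ker(E^Π_N ↠ Π^tp_Y)` —
PROVED: the kernel of `E^Π_N ↠ Π^tp_Y̲` is exactly the image of `μ_N(B_N) ↪ E^Π_N`, given the section
property of `s^⊓-gp_N` and `O^×(B_N) = Ker` (via Lemma 5.9 (ii)).
[cite: MochizukiEtTh2009, Rmk 5.10.3 p.336 (PDF p.110)] -/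
theorem toPiY_ker (hsec : 𝔉.SgpCapSection) :
    𝔉.toPiY.ker = 𝔉.muIncl.range := by
  apply le_antisymm
  · intro x hx
    rw [MonoidHom.mem_ker] at hx
    obtain ⟨⟨e, y⟩, he, hy, hc⟩ := x
    change y = 1 at hx
    subst hx
    have hk : e ∈ (𝔉.autBase 𝔉.BN).ker := by
      rw [MonoidHom.mem_ker]
      exact hc.trans (map_one 𝔉.ρ)
    have hek : e ∈ 𝔉.EN ⊓ (𝔉.autBase 𝔉.BN).ker := Subgroup.mem_inf.mpr ⟨he, hk⟩
    rw [(𝔉.enExact_of hsec).2] at hek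
    exact ⟨⟨e, hek⟩, Subtype.ext rfl⟩
  · rintro _ ⟨u, rfl⟩
    rw [MonoidHom.mem_ker]
    rfl

/-- A "`μ_N`-conjugacy class" of subgroups of `E^Π_N`: the orbit of a subgroup under conjugation by
`μ_N(B_N) ⊆ E^Π_N` (as in Def. 2.10 / abc-iut-L2-t2's `muConjClass`).
[cite: MochizukiEtTh2009, Lem 5.9 (iv) p.332 (PDF p.106)] -/
def muConjClass (H : Subgroup 𝔉.EPiN) : Set (Subgroup 𝔉.EPiN) :=
  {K | ∃ u : 𝔉.muTorsion 𝔉.BN 𝔉.N, K = H.map (MulAut.conj (𝔉.muIncl u)).toMonoidHom}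

/-- **The bi-theta environment data on `E^Π_N`** (Lemma 5.9 (iv), p.332 (PDF p.106)): "the mod `N` bi-theta
environment structure on `E^Π_N` determined by the subgroup of `Out(E^Π_N)` generated by the natural
outer actions of `l·ℤ` [cf. (iii)], `K^×` [cf. Lemma 5.8] on `E_N`, together with the `μ_N`-conjugacy
classes of subgroups given by the images of the homomorphisms `s^⊓-Π_N, s^⊔-Π_N : Π^tp_Ÿ̲ → E^Π_N`."
`DK` = the part of the `K^×`-action not carried by `(O_K^×)^{1/N}` (see the module docstring).
[cite: MochizukiEtTh2009, Lem 5.9 (iv) p.332 (PDF p.106)] -/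
noncomputable def frdBiThetaEnv (h1 : 𝔉.SectionsFactor) (h3 : 𝔉.OuterActionLZ)
    (hsec : 𝔉.SgpCapSection) (hcs : 𝔉.SgpCupSection) (h8 : 𝔉.ConstantsEqNormalizer)
    (DK : Set (TopOut 𝔉.EPiN)) : BiThetaEnv.{v} where
  Pi := 𝔉.EPiN
  D := Subgroup.closure (𝔉.galOut h3 hsec ∪ 𝔉.constOut h8 ∪ DK)
  sTheta := 𝔉.muConjClass (𝔉.sCupPi h1 hcs).range
  sAlg := 𝔉.muConjClass (𝔉.sCapPi hsec).range

/-- "In particular, omitting the homomorphism `s^⊓-Π_N` yields" the mono-theta environment data on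
`E^Π_N` (Lemma 5.9 (iv), p.332).  [cite: MochizukiEtTh2009, Lem 5.9 (iv) p.332 (PDF p.106)] -/
noncomputable def frdMonoThetaEnv (h1 : 𝔉.SectionsFactor) (h3 : 𝔉.OuterActionLZ)
    (hsec : 𝔉.SgpCapSection) (hcs : 𝔉.SgpCupSection) (h8 : 𝔉.ConstantsEqNormalizer)
    (DK : Set (TopOut 𝔉.EPiN)) : MonoThetaEnv.{v} :=
  (𝔉.frdBiThetaEnv h1 h3 hsec hcs h8 DK).toMono

/-- **The Frobenioid-theoretic mono-theta environment** attached to the §5 data under the bundled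
printed facts (Lemma 5.9 (iv) "In particular"; Theorem 5.10 (iii); Rmk. 5.10.1: "a mono-theta
environment may be 'extracted' from the tempered Frobenioids under consideration in a purely
category-theoretic fashion").  [cite: MochizukiEtTh2009, Rmk 5.10.1 p.335 (PDF p.109)] -/
noncomputable def monoThetaEnvOf (H : 𝔉.Facts) (DK : Set (TopOut 𝔉.EPiN)) : MonoThetaEnv.{v} :=
  𝔉.frdMonoThetaEnv H.sectionsFactor 𝔉.outerActionLZ_of H.sgpCapSection H.sgpCupSection
    H.constantsEqNormalizer DK

/-! ### Lemma 5.9 (iv), (v) and Theorem 5.10 (iii) -/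

section Statements

variable (h1 : 𝔉.SectionsFactor) (h3 : 𝔉.OuterActionLZ) (hsec : 𝔉.SgpCapSection)
  (hcs : 𝔉.SgpCupSection) (h8 : 𝔉.ConstantsEqNormalizer) (DK : Set (TopOut 𝔉.EPiN))
  (T : ThetaEnvData.{v} 𝔉.N) (ι : 𝔉.PiX ≃ₜ* T.PiX)

/-- **[EtTh] Lemma 5.9 (iv)** (p.332 (PDF p.106)): "the natural inclusions `μ_N(B_N) ↪ E_N`, `Im(Π^tp_Y) ⊆ E_N`
determine an isomorphism of topological groups `E^Π_N ⥲ Π^tp_Y[μ_N]` which is an isomorphism of mod `N`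
bi-theta environments with respect to the model bi-theta environment structure of Definition 2.13,
(ii), on `Π^tp_Y[μ_N]` and the mod `N` bi-theta environment structure on `E^Π_N` determined by …
[`frdBiThetaEnv`]".  PARAMETERS: abc-iut-L2-t2's `T : ThetaEnvData N` for the same curve and an
identification `ι : Π^tp_X̲ ≃ T.PiX` carrying `Π^tp_Y̲, Π^tp_Ÿ̲` to `T.PiY, T.PiYdd`
(`TODO-merge(abc-iut-L2-t2)`: one interface).  Typed: there are `η ∈ T.thetaCocycles` and an
isomorphism of bi-theta environments `frdBiThetaEnv ≅ T.modelBi η` lying over `ι` on `Π^tp_Y̲` and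
carrying `μ_N(B_N)` into `μ_N`.  [cite: MochizukiEtTh2009, Lem 5.9 (iv) p.332 (PDF p.106)] -/
def EnvIsoBiTheta : Prop :=
  𝔉.PiY.map ι.toMonoidHom = T.PiY ∧ 𝔉.PiYdd.map ι.toMonoidHom = T.PiYdd ∧
  ∃ (η : T.PiYdd → T.mu) (hη : η ∈ T.thetaCocycles)
    (i : (𝔉.frdBiThetaEnv h1 h3 hsec hcs h8 DK).Iso (T.modelBi hη)),
    (∀ x : 𝔉.EPiN, ((CycEnvelope.proj T.augY T.chi (i.e x) : T.PiY) : T.PiX) = ι (𝔉.toPiY x)) ∧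
    ∀ u : 𝔉.muTorsion 𝔉.BN 𝔉.N, i.e (𝔉.muIncl u) ∈ (CycEnvelope.inMu T.augY T.chi).range

/-- **[EtTh] Lemma 5.9 (iv), "In particular"** (p.332 (PDF p.106)): "omitting the homomorphism `s^⊓-Π_N` yields a mod
`N` mono-theta environment" — `frdMonoThetaEnv` IS a mono-theta environment in the sense of Def. 2.13
(ii) (abc-iut-L2-t2's `IsMonoThetaEnv`).  [cite: MochizukiEtTh2009, Lem 5.9 (iv) p.332 (PDF p.106)] -/
def FrdIsMonoThetaEnv : Prop := T.IsMonoThetaEnv (𝔉.frdMonoThetaEnv h1 h3 hsec hcs h8 DK)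

/-- The "In particular" PROVED from Lemma 5.9 (iv): an isomorphism of bi-theta environments with the
model restricts to one of mono-theta environments.  [cite: MochizukiEtTh2009, Lem 5.9 (iv) p.332 (PDF p.106)] -/
theorem frdIsMonoThetaEnv_of (h : 𝔉.EnvIsoBiTheta h1 h3 hsec hcs h8 DK T ι) :
    𝔉.FrdIsMonoThetaEnv h1 h3 hsec hcs h8 DK T := by
  obtain ⟨-, -, η, hη, i, -, -⟩ := h
  exact ⟨η, hη, ⟨i.toMonoIso⟩⟩

/-- **[EtTh] Lemma 5.9 (v)** (p.332 (PDF p.106)): "In the situation of (iv), the cyclotomic rigidity isomorphism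
arising from the theory of §2 [cf. Corollary 2.19, (i)] coincides with the Frobenioid-theoretic
isomorphism of Proposition 5.5 [where we take '`S`' to be `B_N`]."  PARAMETERS: `ρ219`, the §2
isomorphism for the mono-theta environment `E^Π_N` transported to `(l·Δ_Θ)_{B_N} ⊗ ℤ/Nℤ ⥲ μ_N(B_N)`
(abc-iut-L2-t2's Cor. 2.19 (i), `TODO-merge(abc-iut-L2-t2)`), and a Prop. 5.5 rigidity family `ρ`.
[cite: MochizukiEtTh2009, Lem 5.9 (v) p.332 (PDF p.106)] -/
def CycRigidityCoincide (ρ219 : 𝔉.lDeltaModN 𝔉.BN ≃* 𝔉.muTorsion 𝔉.BN 𝔉.N)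
    (ρ : FrobenioidCyclotomicRigidity.RigidityFamily 𝔉) (hB : 𝔉.IsThetaSaturated 𝔉.BN) : Prop :=
  ρ 𝔉.BN hB = ρ219

/-- **[EtTh] Theorem 5.10 (iii)** (p.334 (PDF p.108)): "The operation of applying `Ψ` followed by conjugation by `β`
preserves the `Aut_C(B_N)`-orbit of `ϵ : E^Π_N → Aut_C(B_N)`, in a fashion which is compatible with the
mono-theta environment structure on `E^Π_N` involving `s^⊔-Π_N` … More precisely: there exists a
commutative diagram [`Ψ^Aut ∘ ϵ = (κ ∘ ϵ) ∘ γ`] — where `κ` is an inner automorphism of `Aut_C(B_N)`;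
`γ` is an automorphism of topological groups which determines an automorphism of mono-theta
environments and is compatible with the `Π^tp_X`-conjugacy class of automorphisms of `Π^tp_Y` induced by
`Ψ^bs` [cf. Theorem 4.4]."  PARAMETER `ψY`: an automorphism of `Π^tp_X̲` IN THE CLASS INDUCED BY `Ψ^bs`
(Thm. 4.4 (i)) — v2 (R-9 repair, RQ7 finding F2 of abc-iut-L6-t23 21:13:41Z, shape (F2-a) of abc-iut-L2-d4
22:24:06Z): that membership is now a HYPOTHESIS (`hbase`: `ψY` lies over `Ψ^Aut` through
`ρ : Π^tp_X̲ → Aut_D(B_N^bs)`; `hY`, `hYdd`: it stabilises `Π^tp_Y̲`, `Π^tp_Ÿ̲`), and the conclusion holds for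
a `Π^tp_X̲`-CONJUGATE of `ψY` ("compatible with the `Π^tp_X`-conjugacy class"), as print says; v1
quantified over an arbitrary `ψY`, for which no `γ` exists.  [cite: MochizukiEtTh2009, Thm 5.10 (iii) p.334 (PDF p.108)] -/
def MonoThetaEnvCompat (Ψ : C ≌ C) (β : Ψ.functor.obj 𝔉.BN ≅ 𝔉.BN) (ψY : 𝔉.PiX ≃ₜ* 𝔉.PiX)
    (_hbase : ∀ g : 𝔉.PiX, 𝔉.autBase 𝔉.BN (𝔉.psiAut Ψ β (𝔉.sgpCap (𝔉.ρ g))) = 𝔉.ρ (ψY g))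
    (_hY : 𝔉.PiY.map ψY.toMulEquiv.toMonoidHom = 𝔉.PiY)
    (_hYdd : 𝔉.PiYdd.map ψY.toMulEquiv.toMonoidHom = 𝔉.PiYdd) : Prop :=
  ∃ (x₃ : 𝔉.PiX)
    (γ : (𝔉.frdMonoThetaEnv h1 h3 hsec hcs h8 DK).Iso (𝔉.frdMonoThetaEnv h1 h3 hsec hcs h8 DK))
    (k : Aut 𝔉.BN),
    (∀ x : 𝔉.EPiN, 𝔉.psiAut Ψ β (𝔉.epsilon x) = k * 𝔉.epsilon (γ.e x) * k⁻¹) ∧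
    ∀ x : 𝔉.EPiN, 𝔉.toPiY (γ.e x) = x₃⁻¹ * ψY (𝔉.toPiY x) * x₃

end Statements

end ThetaFrobenioid

end Literature.AnabelianGeometry.EtaleTheta
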